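import Mathlib

/-!
# `BalabanUV.Beta.GAN24.CrossedLedgerClosure` — binder row G-an2-4 ∕ (CONV-C), W-slot (α-0), ROW (C)sym AT LEVELS `≥ 1`, register PART VI row **T6-VAL**
# (the crossed ledger `hX` ∕ `hXu` of the OWNER's two-index tower): **THE LEDGER CLOSED OVER ALL LEVELS — IF THE FORCING's CROSSED VALUES ARE AN EXACT DIFFERENCE
# ALONG THE DEPTH TOWER, `hX` IS ONE EXPLICIT FORMULA FOR THE LEVEL-`0` WILSON PART**, and at the literal's pins that formula is `W m = −4·Lc⁸·(Lc²·(P m)² − 1)`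
# (G-an2-4 CRUX TEAM (2), leaf prover 03 `b2b-balaban-gan24-formalise-leaf-03`, gen 72; journal [LEAF03-G72-INTENT1])

NOT IN PRINT; OUR BOOKKEEPING ([folklore] telescoping over `Finset.antidiagonal` ∕ `Finset.range`, induction on the period index, `linear_combination` ∕ `field_simp` over free
real letters, next to this lineage's `CrossedLedgerUnrolled` (✓ p380360 ∕ p381353) and leaf-06 g55's `CrossedLedgerTelescope` (✓ p380787, whose shapes §3 re-derives as an instance);
`import Mathlib` ONLY — lane-independent (the table-level adapter behind `CrossedLedgerUnrolled` §5 is the companion file `CrossedLedgerClosureRows`); 0 `def`, 0 cited fact, 0 `def … : Prop`, 0 sorry).  HONEST FRAMING (cell contract, verbatim): «discharging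
`BetaPertH` makes Bałaban's UV stability UNCONDITIONAL — a real constructive-QFT result; it is NOT the continuum limit and NOT the Clay problem.»  HONEST DEPENDENCY (verbatim):
«continuum YM on T⁴ ⇐ BetaPertH ∧ nine spine estimates (0/9 proved); BetaPertH ⇐ (D1) ∧ (D4) ∧ CAP+tail; G-an2-4 gates asym, D1 and NE2/3/4.»

WHY.  The state of row T6-VAL after gen 71 ∕ leaf-06 g55: (i) `CrossedLedgerUnrolled.crossed_conserved_iff_of_rows_pairs` — from road-P2's pin rows (top row `LS`-ed with
coefficient `γ`, deep rows entrywise with coefficient `1`, NO pair form) the binder `hX` is, for every ordered distinct pair `(a,b)`, the family of ledger lines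
  (VAL-l)  `(Xc (l+1) − Xc l) + γ·((Σ_{k<l+1} Xf k (l−k) − Σ_{k<l} Xf k (l−1−k)) + (F0 (l+1) − F0 l)) = 0`,
`Xc i` = the forcing's crossed cell value at level `i`, `Xf k m` = its crossed bond-symmetrised face value at level `k` and period index `m`, `F0 m` = the level-`0` member's
crossed face value at period index `m` (the OWNER's base, `32·M²·cE₂·c·(P m)²` in `CrossedLedgerForcing`); (ii) `CrossedLedgerTelescope.valLedger_iff_levelZero` — GRANTED the
depth-tower shapes of the forcing's crossed values (letters K7-a ∕ K7-b ∕ K7-0: `Xf (k+1) m = c (k+1)·(V (k+1) (m+2) − ρ·V (k+2) (m+1))`, `c (k+2) = ρ·c (k+1)`, `κ (i+1) = γ·c (i+1)`,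
`Xf 0 m = c 0·(R m − ρ·V 1 (m+1))`, `c 1 = ρ·c 0`, `Xc (i+1) = κ (i+1)·V (i+1) 1`; HYPOTHESES, typed by nobody for the actual words), every line (VAL-(l+1)) is the
Wilson-level identity `γ·c 0·(R (l+1) − R l) + ΔB = 0`.  THIS FILE (a) isolates WHAT the telescope uses — the POTENTIAL FORM: there are `G : ℕ → ℕ → ℝ` (level, period index)
and `W : ℕ → ℝ` with `Xf (k+1) m = G (k+1) (m+1) − G (k+2) m` (every face value at level `≥ 1` is an exact difference along the anti-diagonal), `Xc (i+1) = γ·G (i+1) 0` (the cell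
value is `γ`× the tower's foot) and `Xf 0 m = W m − G 1 m` (the level-`0` face value is a Wilson-level part minus the tower's first column) — g55's shapes are the instance
`G k n = c k·V k (n+1)`, `W m = c 0·R m` (§3), and the potential form by itself is a NORMAL FORM (§0: for `γ ≠ 0` any values admit one) — g55's prefactor identities say
that the deeper term of the level-`k` face word and the leading term of the level-`(k+1)` face word are THE SAME explicit pairing; (b) closes the bookkeeping the telescope leaves open: the
`l = 0` line (it carries the level-`0` CELL number `Xc 0` — leaf-06 g55's `−2·Lc¹²·(Lc² − 1)` at the pins) and ALL levels at once — `(∀ l, VAL-l)` is EQUIVALENT to ONE closed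
formula `∀ m, γ·W m = Xc 0 − γ·(F0 (m+1) − F0 0)` (no division, `γ` arbitrary), and the RATIO ledger (`hXu` with the charge factor `u` kept, `CrossedLedgerUnrolled` §6) to the
geometric law `γ·(W m + F0 (m+1)) = u^(m+1)·(Xc 0 + γ·F0 0)`; (c) (companion file `CrossedLedgerClosureRows`) the same at TABLE level behind §5 of the unrolled ledger, so that
the binder `hX` in its literal quantifier shape is that formula pair by pair; (d) AT THE LITERAL's PINS (`γ = Lc⁴∕2`, `Xc 0 = −2·Lc¹²·(Lc² − 1)`, `F0 m = 4·Lc⁸·(P m)²`, `P m = Lc^(m+1)`): `hX ⟺ ∀ m, W m = −4·Lc⁸·(Lc²·(P m)² − 1)` —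
the level-`0` forcing's Wilson-level face part must be EXACTLY `−4·Lc⁸·(N_m² − 1)`, `N_m = Lc·P m` the fine period of the face class.  CONCORDANCE (weight 0): leaf-06 g56's D = 2
engine (`K7-NUMERICS-g56.md` §4, per-cell currency) measures the level-`0` remainder as the Wilson flux pairing `R(N) = −½·(1 − N⁻²)` at `N = 3, 9, 27` — the same `(N² − 1)` law up
to the per-cell ∕ lattice normalisation; this file says that law, with exactly this constant in road-P2's currency, is (granted the potential form) EQUIVALENT to `hX`.

WHAT ([folklore]; letters `G Xf : ℕ → ℕ → ℝ` (level, period index), `W Xc F0 : ℕ → ℝ`, `γ u : ℝ`; g55's letters `V : ℕ → ℕ → ℝ`, `c κ R : ℕ → ℝ`, `ρ : ℝ` in §3):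
* §0 **`valLedger_all_iff_cumulative`** ∕ **`ratioLedger_all_iff_cumulative`** — NO HYPOTHESIS: the ledger lines telescope in the level, so `(∀ l, VAL-l) ⟺ ∀ m,
  D (m+1) = Xc 0 + γ·F0 0` with the CUMULATIVE quantity `D (m+1) := Xc (m+1) + γ·(Σ_{k<m+1} Xf k (m−k) + F0 (m+1))` (ratio form: `D (m+1) = u^(m+1)·(Xc 0 + γ·F0 0)`);
  the potential form below is the way to EVALUATE `D (m+1)` — a normal form (always available for `γ ≠ 0`), not an extra assumption; the content of row T6-VAL is the VALUE.
* §1 **`potential_telescope`** ∕ **`faceSum_eq_of_potential`** — `Σ_{k<l+1} Xf k (l−k) = Xf 0 l + (G 1 l − G (l+1) 0)`; **`valLedger_lhs_eq_of_potential`** — the left side of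
  (VAL-(l+1)) without its base bracket is `γ·(W (l+1) − W l)`; **`ratioLedger_lhs_eq_of_potential`** — `Xc (l+1) + γ·(Σ_{k<l+1} Xf k (l−k) + F0 (l+1)) = γ·(W l + F0 (l+1))`.
* §2 **`valLedger_all_iff_of_potential`** — `(∀ l, VAL-l) ⟺ ∀ m, γ·W m = Xc 0 − γ·(F0 (m+1) − F0 0)`; **`ratioLedger_all_iff_of_potential`** — the ratio ledger
  `⟺ ∀ m, γ·(W m + F0 (m+1)) = u^(m+1)·(Xc 0 + γ·F0 0)`; **`valLedger_all_of_wilsonLaw`** — the sufficient form `W m + F0 (m+1) = K`, `Xc 0 = γ·(K − F0 0)`.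
* §3 **`potential_of_depthTower_face`** ∕ **`_cell`** ∕ **`_face0`** — g55's shapes ARE a potential form (`G k n = c k·V k (n+1)`, `W m = c 0·R m`); hence
  **`valLedger_all_iff_remainder`** ∕ **`ratioLedger_all_iff_remainder`** in g55's letters (`W m` spelled `c 0·R m`).
* (§4 = companion `CrossedLedgerClosureRows.crossed_conserved_iff_wilson_of_rows_pairs`, TABLE LEVEL behind `CrossedLedgerUnrolled` §5.)
* §5 **`wilson_target_iff_pin'`** (`C = 32M²cE₂c` and `Xc 0` letters) ∕ **`wilson_target_iff_pin`** ∕ **`valLedger_all_iff_target_pin`** — the pins' arithmetic: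
  `(∀ m, γ·W m = Xc 0 − γ·(F0 (m+1) − F0 0)) ⟺ ∀ m, W m = −4·Lc⁸·(Lc²·(P m)² − 1)`; hence, granted the potential form, at the pins `(∀ l, VAL-l) ⟺` that.
READING (weight 0 until the values are typed for the actual words): row T6-VAL = «the cumulative quantity `D (m+1)` is the level-`0` constant for every `m`» (§0, no
hypothesis) = in the potential form's letters «the Wilson part is `W m = −4·Lc⁸·(N_m² − 1)`» (§5) — the (γ) hand's K7 letters are the route to that VALUE, not hypotheses
of the row.  Asserts NO value and NO shape of Bałaban's tables (every shape is a HYPOTHESIS over free letters; the pins' numbers enter §5 as hypotheses on letters); discharges NOTHING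
of `hX` ∕ `hXu` ∕ `hSrcX` ∕ (C)_{≥1} ∕ `hB0` ∕ `hBF` ∕ (Q-L) ∕ (hW, hWall); NEVER «G-an2-4 closed» as (CONV-C); NOT D1, NOT `BetaPertH`, NOT continuum, NOT Clay.  2026-08-24; no
existing file touched.
-/

open Finset
open scoped BigOperators

namespace Summit.QuantumFields.BalabanUV.Beta.GAN24.CrossedLedgerClosure

variable {G Xf : ℕ → ℕ → ℝ} {W Xc F0 : ℕ → ℝ} {γ : ℝ}

/-! ## §0 No hypothesis at all: the ledger is CUMULATIVE -/

/-- NOT IN PRINT; OUR BOOKKEEPING.  **THE LEDGER LINES TELESCOPE IN THE LEVEL — NO SHAPE NEEDED** (any `Xc Xf F0 γ`): the family of ledger lines (VAL-l) in this lineage's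
spelling holds IF AND ONLY IF the CUMULATIVE quantity `D (m+1) := Xc (m+1) + γ·(Σ_{k<m+1} Xf k (m−k) + F0 (m+1))` is the level-`0` number `Xc 0 + γ·F0 0` for every `m`
(VAL-l is `D (l+1) − D l = 0`, `D 0 = Xc 0 + γ·F0 0`).  So, before any shape is granted, row T6-VAL reads: at every period index `m`, the forcing's crossed cell value at
level `m+1` plus `γ`× the anti-diagonal sum of its crossed face values of total index `m` plus `γ`× the base at `m+1` is ONE constant.  The potential form of §1–§2 is the
(γ) hand's way to EVALUATE `D (m+1)` (it collapses to `γ·(W m + F0 (m+1))`, `ratioLedger_lhs_eq_of_potential`); it is a normal form, not an extra assumption. -/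
theorem valLedger_all_iff_cumulative :
    (∀ l : ℕ, (Xc (l + 1) - Xc l)
        + γ * (((∑ k ∈ range (l + 1), Xf k (l - k)) - ∑ k ∈ range l, Xf k (l - 1 - k)) + (F0 (l + 1) - F0 l)) = 0) ↔
      ∀ m : ℕ, Xc (m + 1) + γ * ((∑ k ∈ range (m + 1), Xf k (m - k)) + F0 (m + 1)) = Xc 0 + γ * F0 0 := by
  -- the level-`(l+1)` "previous" cumulative quantity, up to the index spelling `l + 1 - 1 - k = l - k`
  have hR : ∀ l : ℕ, (∑ k ∈ range (l + 1), Xf k (l + 1 - 1 - k)) = ∑ k ∈ range (l + 1), Xf k (l - k) := by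
    intro l
    have hidx : ∀ k, l + 1 - 1 - k = l - k := fun k => by omega
    simp only [hidx]
  constructor
  · intro h m
    induction m with
    | zero =>
      have h0 := h 0
      rw [sum_range_zero, Nat.zero_add, sum_range_one, Nat.sub_zero] at h0
      rw [sum_range_one, Nat.sub_zero]
      linear_combination h0
    | succ m ih =>
      have hm := h (m + 1)
      rw [hR m] at hm
      linear_combination hm + ih
  · intro h l
    cases l with
    | zero =>
      have h0 := h 0
      rw [sum_range_one, Nat.sub_zero] at h0
      rw [sum_range_zero, Nat.zero_add, sum_range_one, Nat.sub_zero]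
      linear_combination h0
    | succ m =>
      rw [hR m]
      linear_combination h (m + 1) - h m

/-- NOT IN PRINT; OUR BOOKKEEPING.  **THE RATIO LEDGER IS CUMULATIVE-GEOMETRIC — NO SHAPE NEEDED** (any `Xc Xf F0 γ u`): the ratio family
`∀ l, D (l+1) = u·D l` (`CrossedLedgerUnrolled` §6's right side, `u` kept) holds IF AND ONLY IF `∀ m, D (m+1) = u^(m+1)·(Xc 0 + γ·F0 0)`. -/
theorem ratioLedger_all_iff_cumulative (u : ℝ) :
    (∀ l : ℕ, Xc (l + 1) + γ * ((∑ k ∈ range (l + 1), Xf k (l - k)) + F0 (l + 1))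
        = u * (Xc l + γ * ((∑ k ∈ range l, Xf k (l - 1 - k)) + F0 l))) ↔
      ∀ m : ℕ, Xc (m + 1) + γ * ((∑ k ∈ range (m + 1), Xf k (m - k)) + F0 (m + 1)) = u ^ (m + 1) * (Xc 0 + γ * F0 0) := by
  have hR : ∀ l : ℕ, (∑ k ∈ range (l + 1), Xf k (l + 1 - 1 - k)) = ∑ k ∈ range (l + 1), Xf k (l - k) := by
    intro l
    have hidx : ∀ k, l + 1 - 1 - k = l - k := fun k => by omega
    simp only [hidx]
  constructor
  · intro h m
    induction m with
    | zero =>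
      have h0 := h 0
      rw [sum_range_zero, zero_add] at h0
      rw [h0]
      ring
    | succ m ih =>
      have hm := h (m + 1)
      rw [hR m, ih] at hm
      rw [hm]
      ring
  · intro h l
    cases l with
    | zero =>
      rw [sum_range_zero, zero_add, h 0]
      ring
    | succ m =>
      rw [hR m, h (m + 1), h m]
      ring

/-! ## §1 The potential form: face values an exact difference along the depth tower -/

/-- NOT IN PRINT; OUR BOOKKEEPING.  **THE ANTI-DIAGONAL TELESCOPE IN POTENTIAL FORM** (any `G : ℕ → ℕ → ℝ`, every shift `s`, every `n`):
`Σ_{p ∈ antidiagonal n} (G (p.1+1+s) (p.2+1) − G (p.1+2+s) p.2) = G (s+1) (n+1) − G (n+s+2) 0`. -/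
theorem potential_telescope (G : ℕ → ℕ → ℝ) (n s : ℕ) :
    ∑ p ∈ antidiagonal n, (G (p.1 + 1 + s) (p.2 + 1) - G (p.1 + 2 + s) p.2) = G (s + 1) (n + 1) - G (n + s + 2) 0 := by
  induction n generalizing s with
  | zero =>
    rw [Nat.antidiagonal_zero, sum_singleton]
    dsimp only
    rw [show 0 + 1 + s = s + 1 by ring, show 0 + 2 + s = 0 + s + 2 by ring]
  | succ n ih =>
    rw [Nat.sum_antidiagonal_succ]
    dsimp only
    have h1 : ∀ p : ℕ × ℕ, G (p.1 + 1 + 1 + s) (p.2 + 1) - G (p.1 + 1 + 2 + s) p.2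
        = G (p.1 + 1 + (s + 1)) (p.2 + 1) - G (p.1 + 2 + (s + 1)) p.2 := fun p => by
      rw [show p.1 + 1 + 1 + s = p.1 + 1 + (s + 1) by ring, show p.1 + 1 + 2 + s = p.1 + 2 + (s + 1) by ring]
    simp only [h1, ih (s + 1)]
    rw [show 0 + 1 + s = s + 1 by ring, show 0 + 2 + s = s + 1 + 1 by ring, show n + 1 + 1 = n + 2 by ring,
      show n + (s + 1) + 2 = n + 1 + s + 2 by ring]
    ring

/-- NOT IN PRINT; OUR BOOKKEEPING.  **THE FACE SUM OF (VAL-l) IN POTENTIAL FORM**: if every face value at level `≥ 1` is an exact difference along its anti-diagonal,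
`Xf (k+1) m = G (k+1) (m+1) − G (k+2) m`, then `Σ_{k<l+1} Xf k (l−k) = Xf 0 l + (G 1 l − G (l+1) 0)` — the level-`0` word plus the two ENDS of the tower. -/
theorem faceSum_eq_of_potential (hface : ∀ k m, Xf (k + 1) m = G (k + 1) (m + 1) - G (k + 2) m) (l : ℕ) :
    ∑ k ∈ range (l + 1), Xf k (l - k) = Xf 0 l + (G 1 l - G (l + 1) 0) := by
  rw [← Nat.sum_antidiagonal_eq_sum_range_succ (fun k m => Xf k m) l]
  cases l with
  | zero =>
    rw [Nat.antidiagonal_zero, sum_singleton]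
    dsimp only
    ring
  | succ n =>
    rw [Nat.sum_antidiagonal_succ]
    dsimp only
    have h0 : ∀ p : ℕ × ℕ, Xf (p.1 + 1) p.2 = G (p.1 + 1 + 0) (p.2 + 1) - G (p.1 + 2 + 0) p.2 := fun p => by
      rw [Nat.add_zero, Nat.add_zero, hface]
    simp only [h0, potential_telescope G n 0]

/-- NOT IN PRINT; OUR BOOKKEEPING.  **THE DEEP VALUES CANCEL (potential form)**: with the face potential `hface`, the cell values at the tower's foot
`Xc (i+1) = γ·G (i+1) 0` and the level-`0` face values `Xf 0 m = W m − G 1 m`, the left side of (VAL-(l+1)) without its base bracket is `γ·(W (l+1) − W l)`. -/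
theorem valLedger_lhs_eq_of_potential (hface : ∀ k m, Xf (k + 1) m = G (k + 1) (m + 1) - G (k + 2) m)
    (hcell : ∀ i, Xc (i + 1) = γ * G (i + 1) 0) (hface0 : ∀ m, Xf 0 m = W m - G 1 m) (l : ℕ) :
    (Xc (l + 2) - Xc (l + 1)) + γ * (∑ k ∈ range (l + 2), Xf k (l + 1 - k) - ∑ k ∈ range (l + 1), Xf k (l - k))
      = γ * (W (l + 1) - W l) := by
  rw [faceSum_eq_of_potential hface (l + 1), faceSum_eq_of_potential hface l, show l + 2 = l + 1 + 1 by ring, hcell (l + 1), hcell l,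
    hface0 (l + 1), hface0 l]
  ring

/-- NOT IN PRINT; OUR BOOKKEEPING.  **THE LEVEL-`l` LEFT SIDE OF THE RATIO LEDGER (potential form)**: `Xc (l+1) + γ·(Σ_{k<l+1} Xf k (l−k) + F0 (l+1)) = γ·(W l + F0 (l+1))`. -/
theorem ratioLedger_lhs_eq_of_potential (hface : ∀ k m, Xf (k + 1) m = G (k + 1) (m + 1) - G (k + 2) m)
    (hcell : ∀ i, Xc (i + 1) = γ * G (i + 1) 0) (hface0 : ∀ m, Xf 0 m = W m - G 1 m) (l : ℕ) :
    Xc (l + 1) + γ * ((∑ k ∈ range (l + 1), Xf k (l - k)) + F0 (l + 1)) = γ * (W l + F0 (l + 1)) := by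
  rw [faceSum_eq_of_potential hface l, hcell l, hface0 l]
  ring

/-! ## §2 All levels at once -/

/-- NOT IN PRINT; OUR BOOKKEEPING.  **THE WHOLE LEDGER ⟺ ONE FORMULA FOR THE WILSON PART** (potential form; `γ` arbitrary, no division): the family of ledger lines
(VAL-l), `l = 0, 1, 2, …`, in this lineage's spelling (lower anti-diagonal `Σ_{k<l} Xf k (l−1−k)`, base bracket `F0 (l+1) − F0 l` inside `γ`) — i.e. the binder `hX` read as
scalars for one crossed pattern — holds IF AND ONLY IF `∀ m, γ·W m = Xc 0 − γ·(F0 (m+1) − F0 0)`: the level-`0` forcing's Wilson-level face part is AFFINE in the level-`0`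
member's face value one period deeper, both constants fixed by the level-`0` cell number `Xc 0` and the first base value `F0 0`.  (`→`: induction on `m`, the `l = 0` line as
base — there the tower's foot `G 1 0` cancels between `Xc 1` and `Xf 0 0` —, the `l = m+1` line as step; `←`: differences.) -/
theorem valLedger_all_iff_of_potential (hface : ∀ k m, Xf (k + 1) m = G (k + 1) (m + 1) - G (k + 2) m)
    (hcell : ∀ i, Xc (i + 1) = γ * G (i + 1) 0) (hface0 : ∀ m, Xf 0 m = W m - G 1 m) :
    (∀ l : ℕ, (Xc (l + 1) - Xc l)
        + γ * (((∑ k ∈ range (l + 1), Xf k (l - k)) - ∑ k ∈ range l, Xf k (l - 1 - k)) + (F0 (l + 1) - F0 l)) = 0) ↔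
      ∀ m : ℕ, γ * W m = Xc 0 - γ * (F0 (m + 1) - F0 0) := by
  -- the `l = 0` line
  have h0 : (Xc (0 + 1) - Xc 0) + γ * (((∑ k ∈ range (0 + 1), Xf k (0 - k)) - ∑ k ∈ range 0, Xf k (0 - 1 - k)) + (F0 (0 + 1) - F0 0)) = 0 ↔
      γ * W 0 = Xc 0 - γ * (F0 (0 + 1) - F0 0) := by
    rw [Nat.zero_add, sum_range_one, sum_range_zero, Nat.sub_zero, sub_zero, hcell 0, hface0 0]
    constructor
    · intro h
      linear_combination h
    · intro h
      linear_combination h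
  rw [Nat.zero_add] at h0
  -- the `l = m+1` line, in this lineage's index spelling
  have hS : ∀ m : ℕ, (Xc (m + 1 + 1) - Xc (m + 1))
      + γ * (((∑ k ∈ range (m + 1 + 1), Xf k (m + 1 - k)) - ∑ k ∈ range (m + 1), Xf k (m + 1 - 1 - k)) + (F0 (m + 1 + 1) - F0 (m + 1))) = 0 ↔
        γ * (W (m + 1) - W m) + γ * (F0 (m + 1 + 1) - F0 (m + 1)) = 0 := by
    intro m
    have hidx : ∀ k, m + 1 - 1 - k = m - k := fun k => by omega
    simp only [hidx, show m + 1 + 1 = m + 2 by ring]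
    have key := valLedger_lhs_eq_of_potential hface hcell hface0 m
    constructor
    · intro h
      linear_combination h - key
    · intro h
      linear_combination h + key
  constructor
  · intro h m
    induction m with
    | zero => exact h0.1 (h 0)
    | succ m ih =>
      have hm := (hS m).1 (h (m + 1))
      linear_combination hm + ih
  · intro h l
    cases l with
    | zero => exact h0.2 (h 0)
    | succ m =>
      refine (hS m).2 ?_
      linear_combination h (m + 1) - h m

/-- NOT IN PRINT; OUR BOOKKEEPING.  **THE WHOLE RATIO LEDGER ⟺ ONE GEOMETRIC LAW** (potential form; any `γ`, any charge factor `u`): the family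
`∀ l, Xc (l+1) + γ·(Σ_{k<l+1} Xf k (l−k) + F0 (l+1)) = u·(Xc l + γ·(Σ_{k<l} Xf k (l−1−k) + F0 l))` — the binder `hXu` of `PairFormSourceOfMember.sourceCrossed_of_memberCrossed`
read as scalars, `u` NOT rewritten to `1` (the right side of `CrossedLedgerUnrolled.crossed_ratio_iff_of_rows`) — holds IF AND ONLY IF
`∀ m, γ·(W m + F0 (m+1)) = u^(m+1)·(Xc 0 + γ·F0 0)`: the Wilson-level quantity `W m + F0 (m+1)` is GEOMETRIC in the period index with ratio `u`, started at the level-`0`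
number `Xc 0 + γ·F0 0`.  At `u = 1` this is `valLedger_all_iff_of_potential`'s formula. -/
theorem ratioLedger_all_iff_of_potential (hface : ∀ k m, Xf (k + 1) m = G (k + 1) (m + 1) - G (k + 2) m)
    (hcell : ∀ i, Xc (i + 1) = γ * G (i + 1) 0) (hface0 : ∀ m, Xf 0 m = W m - G 1 m) (u : ℝ) :
    (∀ l : ℕ, Xc (l + 1) + γ * ((∑ k ∈ range (l + 1), Xf k (l - k)) + F0 (l + 1))
        = u * (Xc l + γ * ((∑ k ∈ range l, Xf k (l - 1 - k)) + F0 l))) ↔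
      ∀ m : ℕ, γ * (W m + F0 (m + 1)) = u ^ (m + 1) * (Xc 0 + γ * F0 0) := by
  have hL := ratioLedger_lhs_eq_of_potential (F0 := F0) hface hcell hface0
  -- the level-`(l+1)` right side is the level-`l` left side, up to the index spelling `l + 1 - 1 - k = l - k`
  have hR : ∀ l : ℕ, Xc (l + 1) + γ * ((∑ k ∈ range (l + 1), Xf k (l + 1 - 1 - k)) + F0 (l + 1)) = γ * (W l + F0 (l + 1)) := by
    intro l
    have hidx : ∀ k, l + 1 - 1 - k = l - k := fun k => by omega
    simp only [hidx]
    exact hL l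
  constructor
  · intro h m
    induction m with
    | zero =>
      have h0 := h 0
      rw [hL 0, sum_range_zero, zero_add] at h0
      rw [h0]
      ring
    | succ m ih =>
      have hm := h (m + 1)
      rw [hL (m + 1), hR m, ih] at hm
      rw [hm]
      ring
  · intro h l
    cases l with
    | zero =>
      rw [hL 0, sum_range_zero, zero_add, h 0]
      ring
    | succ m =>
      rw [hL (m + 1), hR m, h (m + 1), h m]
      ring

/-- NOT IN PRINT; OUR BOOKKEEPING.  **THE SUFFICIENT FORM: A WILSON LAW AND ONE LEVEL-`0` NUMBER** (potential form): if `W m + F0 (m+1) = K` for every period index (the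
«Wilson law»: the level-`0` Wilson part and the base one period deeper add up to a constant) and `Xc 0 = γ·(K − F0 0)`, every ledger line (VAL-l) holds. -/
theorem valLedger_all_of_wilsonLaw (hface : ∀ k m, Xf (k + 1) m = G (k + 1) (m + 1) - G (k + 2) m)
    (hcell : ∀ i, Xc (i + 1) = γ * G (i + 1) 0) (hface0 : ∀ m, Xf 0 m = W m - G 1 m)
    {K : ℝ} (hW : ∀ m, W m + F0 (m + 1) = K) (hZ : Xc 0 = γ * (K - F0 0)) (l : ℕ) :
    (Xc (l + 1) - Xc l)
        + γ * (((∑ k ∈ range (l + 1), Xf k (l - k)) - ∑ k ∈ range l, Xf k (l - 1 - k)) + (F0 (l + 1) - F0 l)) = 0 := by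
  refine (valLedger_all_iff_of_potential (F0 := F0) hface hcell hface0).2 (fun m => ?_) l
  rw [hZ, show W m = K - F0 (m + 1) from by linear_combination hW m]
  ring

/-! ## §3 leaf-06 g55's depth-tower shapes are a potential form -/

section DepthTower

variable {V : ℕ → ℕ → ℝ} {c κ R : ℕ → ℝ} {ρ : ℝ}

/-- NOT IN PRINT; OUR BOOKKEEPING.  **g55's FACE SHAPE IS A POTENTIAL** (`hface` + `hc` of `CrossedLedgerTelescope`): with `G k n := c k·V k (n+1)`,
`Xf (k+1) m = G (k+1) (m+1) − G (k+2) m`, i.e. `= c (k+1)·V (k+1) (m+2) − c (k+2)·V (k+2) (m+1)`. -/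
theorem potential_of_depthTower_face
    (hface : ∀ k m, Xf (k + 1) m = c (k + 1) * (V (k + 1) (m + 2) - ρ * V (k + 2) (m + 1)))
    (hc : ∀ k, c (k + 2) = ρ * c (k + 1)) (k m : ℕ) :
    Xf (k + 1) m = c (k + 1) * V (k + 1) (m + 1 + 1) - c (k + 2) * V (k + 2) (m + 1) := by
  rw [hface, hc]
  ring

/-- NOT IN PRINT; OUR BOOKKEEPING.  **g55's CELL SHAPE IS THE TOWER's FOOT** (`hcell` + `hκ`): `Xc (i+1) = γ·G (i+1) 0`. -/
theorem potential_of_depthTower_cell (hcell : ∀ i, Xc (i + 1) = κ (i + 1) * V (i + 1) 1) (hκ : ∀ i, κ (i + 1) = γ * c (i + 1)) (i : ℕ) :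
    Xc (i + 1) = γ * (c (i + 1) * V (i + 1) (0 + 1)) := by
  rw [hcell, hκ, Nat.zero_add]
  ring

/-- NOT IN PRINT; OUR BOOKKEEPING.  **g55's LEVEL-`0` SHAPE IS «WILSON PART MINUS FIRST COLUMN»** (`hface0` + `hc0`): with `W m := c 0·R m`, `Xf 0 m = W m − G 1 m`. -/
theorem potential_of_depthTower_face0 (hface0 : ∀ m, Xf 0 m = c 0 * (R m - ρ * V 1 (m + 1))) (hc0 : c 1 = ρ * c 0) (m : ℕ) :
    Xf 0 m = c 0 * R m - c 1 * V 1 (m + 1) := by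
  rw [hface0, hc0]
  ring

/-- NOT IN PRINT; OUR BOOKKEEPING.  **THE WHOLE LEDGER IN g55's LETTERS**: granted `hcell` ∕ `hface` ∕ `hc` ∕ `hκ` ∕ `hface0` ∕ `hc0` of `CrossedLedgerTelescope`,
`(∀ l, VAL-l) ⟺ ∀ m, γ·(c 0·R m) = Xc 0 − γ·(F0 (m+1) − F0 0)`. -/
theorem valLedger_all_iff_remainder
    (hcell : ∀ i, Xc (i + 1) = κ (i + 1) * V (i + 1) 1)
    (hface : ∀ k m, Xf (k + 1) m = c (k + 1) * (V (k + 1) (m + 2) - ρ * V (k + 2) (m + 1)))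
    (hc : ∀ k, c (k + 2) = ρ * c (k + 1)) (hκ : ∀ i, κ (i + 1) = γ * c (i + 1))
    (hface0 : ∀ m, Xf 0 m = c 0 * (R m - ρ * V 1 (m + 1))) (hc0 : c 1 = ρ * c 0) :
    (∀ l : ℕ, (Xc (l + 1) - Xc l)
        + γ * (((∑ k ∈ range (l + 1), Xf k (l - k)) - ∑ k ∈ range l, Xf k (l - 1 - k)) + (F0 (l + 1) - F0 l)) = 0) ↔
      ∀ m : ℕ, γ * (c 0 * R m) = Xc 0 - γ * (F0 (m + 1) - F0 0) :=
  valLedger_all_iff_of_potential (G := fun k n => c k * V k (n + 1)) (W := fun m => c 0 * R m) (F0 := F0)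
    (potential_of_depthTower_face hface hc) (potential_of_depthTower_cell hcell hκ) (potential_of_depthTower_face0 hface0 hc0)

/-- NOT IN PRINT; OUR BOOKKEEPING.  **THE RATIO LEDGER IN g55's LETTERS**: granted the same shapes, for any charge factor `u`,
`(∀ l, LHS (l+1) = u·LHS l) ⟺ ∀ m, γ·(c 0·R m + F0 (m+1)) = u^(m+1)·(Xc 0 + γ·F0 0)`. -/
theorem ratioLedger_all_iff_remainder
    (hcell : ∀ i, Xc (i + 1) = κ (i + 1) * V (i + 1) 1)
    (hface : ∀ k m, Xf (k + 1) m = c (k + 1) * (V (k + 1) (m + 2) - ρ * V (k + 2) (m + 1)))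
    (hc : ∀ k, c (k + 2) = ρ * c (k + 1)) (hκ : ∀ i, κ (i + 1) = γ * c (i + 1))
    (hface0 : ∀ m, Xf 0 m = c 0 * (R m - ρ * V 1 (m + 1))) (hc0 : c 1 = ρ * c 0) (u : ℝ) :
    (∀ l : ℕ, Xc (l + 1) + γ * ((∑ k ∈ range (l + 1), Xf k (l - k)) + F0 (l + 1))
        = u * (Xc l + γ * ((∑ k ∈ range l, Xf k (l - 1 - k)) + F0 l))) ↔
      ∀ m : ℕ, γ * (c 0 * R m + F0 (m + 1)) = u ^ (m + 1) * (Xc 0 + γ * F0 0) :=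
  ratioLedger_all_iff_of_potential (G := fun k n => c k * V k (n + 1)) (W := fun m => c 0 * R m) (F0 := F0)
    (potential_of_depthTower_face hface hc) (potential_of_depthTower_cell hcell hκ) (potential_of_depthTower_face0 hface0 hc0) u

end DepthTower

/-! ## §5 At the literal's pins: the target number for the Wilson part -/

/-- NOT IN PRINT; OUR BOOKKEEPING.  **THE PINS' ARITHMETIC WITH THE BASE CONSTANT AND THE LEVEL-`0` CELL NUMBER AS LETTERS** (`γ = Lc⁴∕2` — road-P2's top coefficient
in `FFsym` currency at `d = 3`, `cE₂ = Lc⁸`; `F0 m = C·(P m)²`, `C = 32·M²·cE₂·c` free — the Wilson quartic's scalars `c`, `M` are free in `CrossedLedgerForcing`; `Xc 0` free;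
`P 0 = Lc`, `P (m+1) = Lc·P m`): the Wilson formula reads `∀ m, W m = (2 ∕ Lc⁴)·Xc 0 − C·Lc²·((P m)² − 1)`. -/
theorem wilson_target_iff_pin' {Lc : ℝ} (hLc : Lc ≠ 0) {P : ℕ → ℝ} (hP0 : P 0 = Lc) (hPs : ∀ m, P (m + 1) = Lc * P m)
    (hγ : γ = Lc ^ 4 / 2) {C : ℝ} (hF0 : ∀ m, F0 m = C * (P m) ^ 2) :
    (∀ m : ℕ, γ * W m = Xc 0 - γ * (F0 (m + 1) - F0 0)) ↔ ∀ m : ℕ, W m = 2 / Lc ^ 4 * Xc 0 - C * Lc ^ 2 * ((P m) ^ 2 - 1) := by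
  have hL4 : Lc ^ 4 ≠ 0 := pow_ne_zero 4 hLc
  refine forall_congr' fun m => ?_
  rw [hγ, hF0 (m + 1), hF0 0, hPs m, hP0]
  constructor
  · intro h
    apply mul_left_cancel₀ hL4
    field_simp
    linear_combination (2 : ℝ) * h
  · intro h
    rw [h]
    field_simp

/-- NOT IN PRINT; OUR BOOKKEEPING.  **THE PINS' ARITHMETIC** (letters; `γ = Lc⁴∕2`; `Xc 0 = −2·Lc¹²·(Lc² − 1)` — leaf-06 g55's `crossed_zmode_forcing_level0_pin` at `cE = Lc⁴`,
`cE₂ = Lc⁸`; `F0 m = 4·Lc⁸·(P m)²` — the OWNER's base `32·M²·cE₂·c·(P m)²` at `c = (8M²)⁻¹`, `cE₂ = Lc⁸`; `P 0 = Lc`, `P (m+1) = Lc·P m`): the Wilson formula reads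
`∀ m, W m = −4·Lc⁸·(Lc²·(P m)² − 1)` — i.e. `−4·Lc⁸·(N_m² − 1)` with `N_m = Lc·P m` the fine period of the period-index-`m` face class. -/
theorem wilson_target_iff_pin {Lc : ℝ} (hLc : Lc ≠ 0) {P : ℕ → ℝ} (hP0 : P 0 = Lc) (hPs : ∀ m, P (m + 1) = Lc * P m)
    (hγ : γ = Lc ^ 4 / 2) (hXc0 : Xc 0 = -2 * Lc ^ 12 * (Lc ^ 2 - 1)) (hF0 : ∀ m, F0 m = 4 * Lc ^ 8 * (P m) ^ 2) :
    (∀ m : ℕ, γ * W m = Xc 0 - γ * (F0 (m + 1) - F0 0)) ↔ ∀ m : ℕ, W m = -4 * Lc ^ 8 * (Lc ^ 2 * (P m) ^ 2 - 1) := by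
  have hL4 : Lc ^ 4 ≠ 0 := pow_ne_zero 4 hLc
  refine forall_congr' fun m => ?_
  rw [hγ, hXc0, hF0 (m + 1), hF0 0, hPs m, hP0]
  constructor
  · intro h
    apply mul_left_cancel₀ hL4
    linear_combination (2 : ℝ) * h
  · intro h
    linear_combination (Lc ^ 4 / 2) * h

/-- NOT IN PRINT; OUR BOOKKEEPING.  **ROW T6-VAL AT THE PINS, GRANTED THE POTENTIAL FORM, IS ONE TARGET NUMBER PER PERIOD** (scalar form for one crossed pattern; the
potential form `hface` ∕ `hcell` ∕ `hface0`, the pins as in `wilson_target_iff_pin`): `(∀ l, VAL-l) ⟺ ∀ m, W m = −4·Lc⁸·(Lc²·(P m)² − 1)`.  What letter K7-0 must deliver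
for the crossed conservation `hX` to hold — and, granted the potential form at levels `≥ 1`, all it must deliver. -/
theorem valLedger_all_iff_target_pin (hface : ∀ k m, Xf (k + 1) m = G (k + 1) (m + 1) - G (k + 2) m)
    (hcell : ∀ i, Xc (i + 1) = γ * G (i + 1) 0) (hface0 : ∀ m, Xf 0 m = W m - G 1 m)
    {Lc : ℝ} (hLc : Lc ≠ 0) {P : ℕ → ℝ} (hP0 : P 0 = Lc) (hPs : ∀ m, P (m + 1) = Lc * P m)
    (hγ : γ = Lc ^ 4 / 2) (hXc0 : Xc 0 = -2 * Lc ^ 12 * (Lc ^ 2 - 1)) (hF0 : ∀ m, F0 m = 4 * Lc ^ 8 * (P m) ^ 2) :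
    (∀ l : ℕ, (Xc (l + 1) - Xc l)
        + γ * (((∑ k ∈ range (l + 1), Xf k (l - k)) - ∑ k ∈ range l, Xf k (l - 1 - k)) + (F0 (l + 1) - F0 l)) = 0) ↔
      ∀ m : ℕ, W m = -4 * Lc ^ 8 * (Lc ^ 2 * (P m) ^ 2 - 1) :=
  (valLedger_all_iff_of_potential (F0 := F0) hface hcell hface0).trans (wilson_target_iff_pin hLc hP0 hPs hγ hXc0 hF0)

end Summit.QuantumFields.BalabanUV.Beta.GAN24.CrossedLedgerClosure
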